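import Summits.Parity.BatemanHorn.Theorems.SoloInformedInterClassCeiling
import Literature.NumberTheory.LFunctions.PolynomialRootChebyshev

/-!
# No class-wise scale profile with the largest prime factor of the modulus passive

Informed soloist `solo-Parity-informed` (session 146), conjunct `BatemanHorn`, the `d ≥ 3` rung BELOW the parity
wall (`ErdosDivisorSumAsymptotic g` for an irreducible cubic `g` ⟸ the `ℓ¹` scale profile `HooleyMeanProfile g θ η`,
`θ > 2/3`, `η > 1/3`, of the sums `T(h) = ∑_{E<e≤E'} S_g(h;e)` of the root exponential sums
`S_g(h;e) = ∑_{ν mod e, g(ν)≡0} e(hν/e)`).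

`SoloInformedInterClassCeiling` proved the Fejér-positivity CEILING of every class-wise method: if the moduli
`e ∈ (E, E']` are labelled by `c` and the absolute values are taken class by class
(`∑_a ‖∑_{e : c(e)=a} S_g(h;e)‖`), then every set `P` of rooted witnesses separated by the labelling into classes of
at most `M` root points costs `(H − M)·#P`, and the class-wise profile hypothesis `ClasswiseMeanProfile g c θ η`
forces `(H − M)·#P ≤ ε·E + C·H·E^{1−η}` (`ClasswiseMeanProfile.sub_mul_card_separated_le`).  Its docstring recorded
in PROSE the instance `c = P⁺` (largest prime factor): "`#P ≫_g E/log E` by Chebotarev–Frobenius".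

This file makes that instance a KERNEL THEOREM, with no appeal to Chebotarev's theorem beyond what the tree
already proves — the prime ideal theorem along `g` with log-square saving,
`Literature.NumberTheory.LFunctions.DegreeOnePrimes.abs_thetaRoot_sub_self_le`
(`|∑_{p≤t} ρ_g(p) log p − t| ≤ C t/log² t`):

* `exists_le_sum_Ioc_rootCount_log` — `∑_{E<p≤2E} ρ_g(p) log p ≥ E/2` for `E ≥ E₁(g)`;
* `exists_le_card_rootedPrimes` — the primes `p ∈ (E, 2E]` at which `g` has a root number at least
  `E/(2·deg g·log(2E))` for `E ≥ E₁(g)`;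
* `filter_largestPrimeFactor_eq_subset_singleton` — for a prime `p ∈ (E, E']`, `E' ≤ 2E`, the class
  `{e ∈ (E, E'] : P⁺(e) = p}` is `⊆ {p}`, so it carries at most `deg g` root points
  (`card_rootPointsOn_class_prime_le`);
* `ClasswiseMeanProfile.sub_mul_card_rootedPrimes_le` — hence a class-wise profile for the labelling `P⁺` forces
  `(H − deg g)·#{E<p≤E' rooted} ≤ ε·E + C·H·E^{1−η}` on every admissible range and scale;
* **`not_classwiseMeanProfile_largestPrimeFactor`** — for `g` irreducible of positive degree and ANY `θ > 0`,
  `η > 0`: `¬ ClasswiseMeanProfile g P⁺ θ η`.  (At `E' = 2E`, `H = ⌊E^θ⌋`, `ε = 1` the forced inequality reads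
  `E^θ·E/(4·deg g·log(2E)) ≤ E + C·E^θ·E^{1−η}`, false for large `E` since `log(2E) = o(E^θ)` and
  `log(2E) = o(E^η)`.)

Reading (SHARPEST-STATEMENT §4.A of the line; prose).  The rung needs, in the profile currency, the bound
`∑_{1≤|h|≤H} ‖T(h)‖ ≤ ε·E + C·H·E^{1−η}` with `η > 1/3` up to `H = E^θ`, `θ > 2/3`.  The theorem says that NO
exponents `θ, η > 0` whatsoever are reachable by an argument that writes `e = m·P⁺(e)`, lets the cofactor `m` cancel
INSIDE an absolute value and sums the largest prime factor OUTSIDE it (Hooley's shape `e = ab` with the large prime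
passive, every "smooth-part dispersion"): the prime moduli of `(E, 2E]` alone — `≍_g E/log E` of them rooted, each
its own class with `≤ deg g` root points — saturate Fejér positivity at scale `H ≍ log E`.  The largest prime
factor of the modulus must be an ACTIVE variable: the rung requires cancellation in sums over PRIMES `p ≍ E^{u}` of
the root data `ν/p` of `g`, i.e. exactly the equidistribution / Kloosterman-type input for roots to PRIME moduli
that is open for `deg g ≥ 3` (Remark 20.29 (xxv), (xxxi) of the companion paper).  Nothing here touches a
parity-blocked statement; the file constrains the SHAPE of a proof of the open rung.
-/

namespace Summit.Parity.BatemanHorn.Theorems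

open Finset Polynomial Filter Literature.NumberTheory.Sieve
open Literature.Barriers.ABC (largestPrimeFactor largestPrimeFactor_def)

/-! ### The largest prime factor: two folklore facts -/

/-- `P⁺(p) = p` for a prime `p`. [folklore] -/
theorem largestPrimeFactor_prime {p : ℕ} (hp : p.Prime) : largestPrimeFactor p = p := by
  rw [largestPrimeFactor_def, hp.primeFactors, sup_singleton, id_eq]
  exact max_eq_right hp.one_lt.le

/-- If `P⁺(e)` is a prime `p` then `p ∣ e`. [folklore] -/
theorem dvd_of_largestPrimeFactor_eq {e p : ℕ} (hp : p.Prime) (h : largestPrimeFactor e = p) : p ∣ e := by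
  rcases e.primeFactors.eq_empty_or_nonempty with h0 | hne
  · exfalso
    rw [largestPrimeFactor_def, h0, sup_empty, Nat.bot_eq_zero, max_eq_left zero_le_one] at h
    exact hp.one_lt.ne h
  · obtain ⟨q, hq, hsup⟩ := exists_mem_eq_sup _ hne id
    have hq2 : 2 ≤ q := (Nat.prime_of_mem_primeFactors hq).two_le
    rw [largestPrimeFactor_def, hsup, id_eq, max_eq_right (by omega : 1 ≤ q)] at h
    rw [← h]
    exact Nat.dvd_of_mem_primeFactors hq

/-! ### The class of a large prime under `P⁺` is a singleton -/

/-- For a prime `p ∈ (E, E']` with `E' ≤ 2E`, the class `{e ∈ (E, E'] : P⁺(e) = p}` is contained in `{p}`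
(`p ∣ e ≤ E' ≤ 2E < 2p`). [this work] -/
theorem filter_largestPrimeFactor_eq_subset_singleton {E E' p : ℕ} (hp : p.Prime) (hEp : E < p)
    (hE' : E' ≤ 2 * E) : {e ∈ Ioc E E' | largestPrimeFactor e = p} ⊆ {p} := by
  intro e he
  rw [mem_filter, mem_Ioc] at he
  obtain ⟨⟨hEe, heE'⟩, hc⟩ := he
  obtain ⟨m, rfl⟩ := dvd_of_largestPrimeFactor_eq hp hc
  rw [mem_singleton]
  have hm0 : m ≠ 0 := by
    rintro rfl
    rw [mul_zero] at hEe
    exact Nat.not_lt_zero E hEe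
  have hlt : p * m < p * 2 :=
    calc p * m ≤ E' := heE'
      _ ≤ 2 * E := hE'
      _ < 2 * p := by omega
      _ = p * 2 := by ring
  have hm2 : m < 2 := Nat.lt_of_mul_lt_mul_left hlt
  have hm1 : m = 1 := by omega
  rw [hm1, mul_one]

/-- Hence the class of such a prime carries at most `deg g` root points of an irreducible `g` of positive degree.
[this work] -/
theorem card_rootPointsOn_class_prime_le {g : ℤ[X]} (hirr : Irreducible g) (hdeg : 0 < g.natDegree)
    {E E' p : ℕ} (hp : p.Prime) (hEp : E < p) (hE' : E' ≤ 2 * E) :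
    #(rootPointsOn g {e ∈ Ioc E E' | largestPrimeFactor e = p}) ≤ g.natDegree :=
  calc #(rootPointsOn g {e ∈ Ioc E E' | largestPrimeFactor e = p})
      ≤ #(rootPointsOn g {p}) :=
        card_rootPointsOn_mono g (filter_largestPrimeFactor_eq_subset_singleton hp hEp hE')
    _ = polyRootCountMod ![g] p := by rw [card_rootPointsOn, sum_singleton]
    _ ≤ g.natDegree := polyRootCountMod_prime_le_natDegree_of_irreducible hirr hdeg hp

/-! ### Rooted primes in a dyadic block -/

/-- The primes `p ∈ (E, E']` at which `g` has a root (`ρ_g(p) ≥ 1`). [this work] -/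
def rootedPrimes (g : ℤ[X]) (E E' : ℕ) : Finset ℕ :=
  {p ∈ Ioc E E' | p.Prime ∧ 1 ≤ polyRootCountMod ![g] p}

/-- `∑_{p ≤ E'} f(p) − ∑_{p ≤ E} f(p) = ∑_{E < p ≤ E', p prime} f(p)`. [folklore] -/
theorem sum_primesLE_sub_sum_primesLE (f : ℕ → ℝ) {E E' : ℕ} (h : E ≤ E') :
    ∑ p ∈ Nat.primesLE E', f p - ∑ p ∈ Nat.primesLE E, f p = ∑ p ∈ (Ioc E E').filter Nat.Prime, f p := by
  have hsub : Nat.primesLE E ⊆ Nat.primesLE E' := fun p hp => by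
    rw [Nat.mem_primesLE] at hp ⊢
    exact ⟨hp.1.trans h, hp.2⟩
  have hsd : Nat.primesLE E' \ Nat.primesLE E = (Ioc E E').filter Nat.Prime := by
    ext p
    simp only [Finset.mem_sdiff, Nat.mem_primesLE, Finset.mem_filter, Finset.mem_Ioc]
    constructor
    · intro hp
      obtain ⟨⟨h1, h2⟩, h3⟩ := hp
      exact ⟨⟨not_le.mp fun hle => h3 ⟨hle, h2⟩, h1⟩, h2⟩
    · intro hp
      obtain ⟨⟨h1, h2⟩, h3⟩ := hp
      exact ⟨⟨h2, h3⟩, fun h4 => absurd h1 (not_lt.mpr h4.1)⟩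
  rw [← hsd, Finset.sum_sdiff_eq_sub hsub]

/-- **Rooted primes in `(E, 2E]`, weighted**: for `g` irreducible of positive degree,
`∑_{E<p≤2E} ρ_g(p) log p ≥ E/2` for all large `E` — from the prime ideal theorem along `g` with log-square saving
(`DegreeOnePrimes.abs_thetaRoot_sub_self_le`). [this work] -/
theorem exists_le_sum_Ioc_rootCount_log {g : ℤ[X]} (hirr : Irreducible g) (hdeg : 0 < g.natDegree) :
    ∃ E₁ : ℕ, ∀ E : ℕ, E₁ ≤ E →
      (E : ℝ) / 2 ≤ ∑ p ∈ (Ioc E (2 * E)).filter Nat.Prime, (polyRootCountMod ![g] p : ℝ) * Real.log p := by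
  obtain ⟨C, hC0, hC⟩ :=
    Literature.NumberTheory.LFunctions.DegreeOnePrimes.abs_thetaRoot_sub_self_le hirr hdeg
  refine ⟨⌈Real.exp (6 * C + 1)⌉₊ + 2, fun E hE => ?_⟩
  have hE2 : (2 : ℝ) ≤ E := by exact_mod_cast (by omega : 2 ≤ E)
  have hEpos : (0 : ℝ) < E := by linarith
  have hexp : Real.exp (6 * C + 1) ≤ E :=
    (Nat.le_ceil _).trans (by exact_mod_cast (by omega : ⌈Real.exp (6 * C + 1)⌉₊ ≤ E))
  have hlogE : 6 * C + 1 ≤ Real.log E := by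
    rw [← Real.log_exp (6 * C + 1)]
    exact Real.log_le_log (Real.exp_pos _) hexp
  have hlog2E : Real.log E ≤ Real.log ((2 * E : ℕ) : ℝ) := by
    push_cast
    exact Real.log_le_log hEpos (by linarith)
  -- the error terms `C t / log² t ≤ t/6` once `log² t ≥ log t ≥ 6C + 1`
  have key : ∀ t : ℝ, 0 ≤ t → 6 * C + 1 ≤ Real.log t → C * t / Real.log t ^ 2 ≤ t / 6 := by
    intro t ht hlt
    have hl1 : 1 ≤ Real.log t := by linarith
    have hl2 : 6 * C + 1 ≤ Real.log t ^ 2 := hlt.trans (le_self_pow₀ hl1 two_ne_zero)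
    have hpos : 0 < Real.log t ^ 2 := by positivity
    rw [div_le_div_iff₀ hpos (by norm_num : (0 : ℝ) < 6)]
    nlinarith [mul_le_mul_of_nonneg_left hl2 ht]
  have h1 := hC (E : ℕ) hE2
  have h2 := hC ((2 * E : ℕ) : ℝ) (by push_cast; linarith)
  rw [Nat.floor_natCast] at h1 h2
  have h1' := (abs_le.mp h1).2
  have h2' := (abs_le.mp h2).1
  have k1 := key (E : ℝ) hEpos.le hlogE
  have k2 := key ((2 * E : ℕ) : ℝ) (by positivity) (hlogE.trans hlog2E)
  rw [← sum_primesLE_sub_sum_primesLE _ (by omega : E ≤ 2 * E)]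
  push_cast at h2' k2 ⊢
  linarith

/-- `∑_{E<p≤E', p prime} ρ_g(p) log p ≤ deg g · log E' · #(rooted primes in (E, E'])` (`ρ_g(p) ≤ deg g` at every
prime for irreducible `g` of positive degree). [this work] -/
theorem sum_Ioc_rootCount_log_le_card_mul {g : ℤ[X]} (hirr : Irreducible g) (hdeg : 0 < g.natDegree)
    (E E' : ℕ) :
    ∑ p ∈ (Ioc E E').filter Nat.Prime, (polyRootCountMod ![g] p : ℝ) * Real.log p ≤
      g.natDegree * Real.log E' * #(rootedPrimes g E E') := by
  have hsub : rootedPrimes g E E' ⊆ (Ioc E E').filter Nat.Prime := fun p hp => by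
    rw [rootedPrimes, mem_filter] at hp
    exact mem_filter.mpr ⟨hp.1, hp.2.1⟩
  have heq : ∑ p ∈ (Ioc E E').filter Nat.Prime, (polyRootCountMod ![g] p : ℝ) * Real.log p =
      ∑ p ∈ rootedPrimes g E E', (polyRootCountMod ![g] p : ℝ) * Real.log p := by
    refine (sum_subset hsub fun p hp hnp => ?_).symm
    have h0 : polyRootCountMod ![g] p = 0 := by
      by_contra h
      exact hnp (mem_filter.mpr ⟨(mem_filter.mp hp).1, (mem_filter.mp hp).2, Nat.one_le_iff_ne_zero.mpr h⟩)
    rw [h0, Nat.cast_zero, zero_mul]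
  rw [heq]
  have hterm : ∀ p ∈ rootedPrimes g E E',
      (polyRootCountMod ![g] p : ℝ) * Real.log p ≤ g.natDegree * Real.log E' := by
    intro p hp
    rw [rootedPrimes, mem_filter, mem_Ioc] at hp
    obtain ⟨⟨hEp, hpE'⟩, hpr, _⟩ := hp
    have hp0 : (0 : ℝ) < p := by exact_mod_cast hpr.pos
    have hlog : Real.log p ≤ Real.log E' := Real.log_le_log hp0 (by exact_mod_cast hpE')
    have hlog0 : 0 ≤ Real.log p := Real.log_nonneg (by exact_mod_cast hpr.one_lt.le)
    have hρ : (polyRootCountMod ![g] p : ℝ) ≤ g.natDegree := by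
      exact_mod_cast polyRootCountMod_prime_le_natDegree_of_irreducible hirr hdeg hpr
    exact mul_le_mul hρ hlog hlog0 (Nat.cast_nonneg _)
  calc ∑ p ∈ rootedPrimes g E E', (polyRootCountMod ![g] p : ℝ) * Real.log p
      ≤ ∑ p ∈ rootedPrimes g E E', (g.natDegree : ℝ) * Real.log E' := sum_le_sum hterm
    _ = g.natDegree * Real.log E' * #(rootedPrimes g E E') := by
        rw [sum_const, nsmul_eq_mul]
        ring

/-- **Rooted primes in `(E, 2E]`**: for `g` irreducible of positive degree and all large `E`,
`E ≤ 2·deg g·log(2E)·#{p ∈ (E, 2E] prime : ρ_g(p) ≥ 1}`. [this work] -/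
theorem exists_le_card_rootedPrimes {g : ℤ[X]} (hirr : Irreducible g) (hdeg : 0 < g.natDegree) :
    ∃ E₁ : ℕ, ∀ E : ℕ, E₁ ≤ E →
      (E : ℝ) ≤ 2 * g.natDegree * Real.log (2 * (E : ℝ)) * #(rootedPrimes g E (2 * E)) := by
  obtain ⟨E₁, hE₁⟩ := exists_le_sum_Ioc_rootCount_log hirr hdeg
  refine ⟨E₁, fun E hE => ?_⟩
  have h1 := hE₁ E hE
  have h2 := sum_Ioc_rootCount_log_le_card_mul hirr hdeg E (2 * E)
  push_cast at h2
  linarith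

/-! ### The class-wise profile for `P⁺` and the rooted primes -/

/-- A class-wise profile for the labelling of the moduli by their largest prime factor forces, on every admissible
range `(E, E']` and scale `H ≤ E^θ`, `(H − deg g)·#{E < p ≤ E' rooted} ≤ ε·E + C·H·E^{1−η}`: the rooted primes are
witnesses (`w(p) = p`, `P⁺(p) = p`) separated into singleton classes of `≤ deg g` root points. [this work] -/
theorem ClasswiseMeanProfile.sub_mul_card_rootedPrimes_le {g : ℤ[X]} {θ η : ℝ} (hirr : Irreducible g)
    (hdeg : 0 < g.natDegree) (hyp : ClasswiseMeanProfile g largestPrimeFactor θ η) :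
    ∃ C : ℝ, ∀ ε : ℝ, 0 < ε → ∃ E₀ : ℕ, ∀ E E' H : ℕ, E₀ ≤ E → 1 ≤ E → E ≤ E' → E' ≤ 2 * E →
      (H : ℝ) ≤ (E : ℝ) ^ θ →
      ((H : ℝ) - g.natDegree) * #(rootedPrimes g E E') ≤ ε * E + C * H * (E : ℝ) ^ (1 - η) := by
  obtain ⟨C, hC⟩ := hyp.sub_mul_card_separated_le
  refine ⟨C, fun ε hε => ?_⟩
  obtain ⟨E₀, hE₀⟩ := hC ε hε
  refine ⟨E₀, fun E E' H h0 hE hEE' hE' hH =>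
    hE₀ E E' H h0 hE hEE' hE' hH g.natDegree (rootedPrimes g E E') (fun p => p) (fun p hp => ?_)
      (fun p hp => ?_) (fun p hp p' hp' heq => ?_) fun p hp => ?_⟩
  · exact (mem_filter.mp hp).1
  · exact (mem_filter.mp hp).2.2
  · have h1 : p.Prime := (mem_filter.mp (mem_coe.mp hp)).2.1
    have h1' : p'.Prime := (mem_filter.mp (mem_coe.mp hp')).2.1
    have heq' : largestPrimeFactor p = largestPrimeFactor p' := heq
    rwa [largestPrimeFactor_prime h1, largestPrimeFactor_prime h1'] at heq'
  · obtain ⟨hpI, hpr, _⟩ := mem_filter.mp hp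
    show #(rootPointsOn g {e ∈ Ioc E E' | largestPrimeFactor e = largestPrimeFactor p}) ≤ g.natDegree
    rw [largestPrimeFactor_prime hpr]
    exact card_rootPointsOn_class_prime_le hirr hdeg hpr (mem_Ioc.mp hpI).1 hE'

/-! ### The growth lemma and the theorem -/

/-- `A·log(2n) ≤ n^r` for all large `n` (`log x = o(x^r)`, `r > 0`). [folklore] -/
theorem eventually_mul_log_le_rpow (A : ℝ) {r : ℝ} (hr : 0 < r) :
    ∀ᶠ n : ℕ in atTop, A * Real.log (2 * (n : ℝ)) ≤ (n : ℝ) ^ r := by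
  have h1 : ∀ᶠ x : ℝ in atTop, ‖2 * |A| * Real.log x‖ ≤ 1 * ‖x ^ r‖ :=
    ((isLittleO_log_rpow_atTop hr).const_mul_left (2 * |A|)).bound one_pos
  have h2 : ∀ᶠ n : ℕ in atTop, ‖2 * |A| * Real.log (n : ℝ)‖ ≤ 1 * ‖(n : ℝ) ^ r‖ :=
    tendsto_natCast_atTop_atTop.eventually h1
  filter_upwards [h2, eventually_ge_atTop 2] with n hn hn2
  have hn' : (2 : ℝ) ≤ n := by exact_mod_cast hn2
  have hrpow0 : 0 ≤ (n : ℝ) ^ r := Real.rpow_nonneg (by linarith) r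
  rw [one_mul, Real.norm_eq_abs ((n : ℝ) ^ r), abs_of_nonneg hrpow0] at hn
  have hlog2n : Real.log (2 * (n : ℝ)) ≤ 2 * Real.log (n : ℝ) := by
    rw [Real.log_mul two_ne_zero (show (0 : ℝ) < n by linarith).ne', two_mul]
    exact add_le_add (Real.log_le_log two_pos hn') le_rfl
  have hlog2n0 : 0 ≤ Real.log (2 * (n : ℝ)) := Real.log_nonneg (by linarith)
  calc A * Real.log (2 * (n : ℝ))
      ≤ |A| * Real.log (2 * (n : ℝ)) := mul_le_mul_of_nonneg_right (le_abs_self A) hlog2n0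
    _ ≤ |A| * (2 * Real.log (n : ℝ)) := mul_le_mul_of_nonneg_left hlog2n (abs_nonneg A)
    _ = 2 * |A| * Real.log (n : ℝ) := by ring
    _ ≤ ‖2 * |A| * Real.log (n : ℝ)‖ := Real.le_norm_self _
    _ ≤ (n : ℝ) ^ r := hn

/-- **No class-wise profile with the largest prime factor passive.**  For `g ∈ ℤ[X]` irreducible of positive
degree and any `θ > 0`, `η > 0`, the class-wise scale profile `ClasswiseMeanProfile g P⁺ θ η` — the bound
`∑_{1≤|h|≤H} ∑_p ‖∑_{E<e≤E', P⁺(e)=p} S_g(h;e)‖ ≤ ε·E + C·H·E^{1−η}` for `H ≤ E^θ`, `E ≥ E₀(ε)` — is FALSE: the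
rooted prime moduli of `(E, 2E]` (`≥ E/(2·deg g·log(2E))` of them, each a singleton class) saturate Fejér
positivity at scale `H ≍ log E`. [this work] -/
theorem not_classwiseMeanProfile_largestPrimeFactor {g : ℤ[X]} (hirr : Irreducible g)
    (hdeg : 0 < g.natDegree) {θ η : ℝ} (hθ : 0 < θ) (hη : 0 < η) :
    ¬ ClasswiseMeanProfile g largestPrimeFactor θ η := by
  intro hyp
  obtain ⟨C, hC⟩ := hyp.sub_mul_card_rootedPrimes_le hirr hdeg
  obtain ⟨E₀, hE₀⟩ := hC 1 one_pos
  obtain ⟨E₁, hE₁⟩ := exists_le_card_rootedPrimes hirr hdeg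
  -- the thresholds
  have ev1 : ∀ᶠ n : ℕ in atTop, (32 * g.natDegree : ℝ) * Real.log (2 * (n : ℝ)) ≤ (n : ℝ) ^ θ :=
    eventually_mul_log_le_rpow _ hθ
  have ev2 : ∀ᶠ n : ℕ in atTop, (32 * g.natDegree * max C 0 : ℝ) * Real.log (2 * (n : ℝ)) ≤ (n : ℝ) ^ η :=
    eventually_mul_log_le_rpow _ hη
  have ev3 : ∀ᶠ n : ℕ in atTop, (2 * (g.natDegree + 1) : ℝ) ≤ (n : ℝ) ^ θ :=
    ((tendsto_rpow_atTop hθ).comp tendsto_natCast_atTop_atTop).eventually_ge_atTop _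
  obtain ⟨E, h1, h2, h3, h4, h5, h6⟩ := (ev1.and (ev2.and (ev3.and ((eventually_ge_atTop E₀).and
    ((eventually_ge_atTop E₁).and (eventually_ge_atTop 2)))))).exists
  have h3' : (2 * (g.natDegree + 1) : ℝ) ≤ (E : ℝ) ^ θ := h3
  -- the data at `E`
  have hE2 : (2 : ℝ) ≤ E := by exact_mod_cast h6
  have hEpos : (0 : ℝ) < E := by linarith
  have hT0 : 0 < (E : ℝ) ^ θ := Real.rpow_pos_of_pos hEpos θ
  have hS0 : 0 < (E : ℝ) ^ η := Real.rpow_pos_of_pos hEpos η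
  have hX0 : 0 ≤ (E : ℝ) ^ (1 - η) := Real.rpow_nonneg hEpos.le _
  have hXS : (E : ℝ) ^ (1 - η) * (E : ℝ) ^ η = E := by
    rw [← Real.rpow_add hEpos, sub_add_cancel, Real.rpow_one]
  have hL0 : 0 < Real.log (2 * (E : ℝ)) := Real.log_pos (by linarith)
  have hHT : (⌊(E : ℝ) ^ θ⌋₊ : ℝ) ≤ (E : ℝ) ^ θ := Nat.floor_le hT0.le
  have hTH : (E : ℝ) ^ θ - 1 ≤ (⌊(E : ℝ) ^ θ⌋₊ : ℝ) := by
    have := Nat.lt_floor_add_one ((E : ℝ) ^ θ)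
    linarith
  have hH0 : (0 : ℝ) ≤ (⌊(E : ℝ) ^ θ⌋₊ : ℝ) := Nat.cast_nonneg _
  -- the forced inequality and the count
  have main := hE₀ E (2 * E) ⌊(E : ℝ) ^ θ⌋₊ h4 (by omega) (by omega) le_rfl hHT
  have hP := hE₁ E h5
  have hP0 : (0 : ℝ) ≤ #(rootedPrimes g E (2 * E)) := Nat.cast_nonneg _
  have hCp0 : (0 : ℝ) ≤ max C 0 := le_max_right _ _
  have hd0 : (0 : ℝ) ≤ g.natDegree := Nat.cast_nonneg _
  -- `(H − d) ≥ E^θ/2` and `C·H·E^{1−η} ≤ C⁺·E^θ·E^{1−η}`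
  have hHd : (E : ℝ) ^ θ / 2 ≤ (⌊(E : ℝ) ^ θ⌋₊ : ℝ) - g.natDegree := by linarith
  have hCH : C * ⌊(E : ℝ) ^ θ⌋₊ * (E : ℝ) ^ (1 - η) ≤ max C 0 * (E : ℝ) ^ θ * (E : ℝ) ^ (1 - η) := by
    have i1 : C * ⌊(E : ℝ) ^ θ⌋₊ ≤ max C 0 * ⌊(E : ℝ) ^ θ⌋₊ :=
      mul_le_mul_of_nonneg_right (le_max_left _ _) hH0
    have i2 : max C 0 * ⌊(E : ℝ) ^ θ⌋₊ ≤ max C 0 * (E : ℝ) ^ θ := mul_le_mul_of_nonneg_left hHT hCp0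
    exact mul_le_mul_of_nonneg_right (i1.trans i2) hX0
  have key : (E : ℝ) ^ θ / 2 * #(rootedPrimes g E (2 * E)) ≤
      E + max C 0 * (E : ℝ) ^ θ * (E : ℝ) ^ (1 - η) :=
    calc (E : ℝ) ^ θ / 2 * #(rootedPrimes g E (2 * E))
        ≤ ((⌊(E : ℝ) ^ θ⌋₊ : ℝ) - g.natDegree) * #(rootedPrimes g E (2 * E)) :=
          mul_le_mul_of_nonneg_right hHd hP0
      _ ≤ 1 * E + C * ⌊(E : ℝ) ^ θ⌋₊ * (E : ℝ) ^ (1 - η) := main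
      _ ≤ _ := by linarith
  -- multiply by `E^η`
  have key2 : (E : ℝ) ^ θ / 2 * #(rootedPrimes g E (2 * E)) * (E : ℝ) ^ η ≤
      E * (E : ℝ) ^ η + max C 0 * (E : ℝ) ^ θ * E :=
    calc (E : ℝ) ^ θ / 2 * #(rootedPrimes g E (2 * E)) * (E : ℝ) ^ η
        ≤ (E + max C 0 * (E : ℝ) ^ θ * (E : ℝ) ^ (1 - η)) * (E : ℝ) ^ η :=
          mul_le_mul_of_nonneg_right key hS0.le
      _ = E * (E : ℝ) ^ η + max C 0 * (E : ℝ) ^ θ * ((E : ℝ) ^ (1 - η) * (E : ℝ) ^ η) := by ring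
      _ = E * (E : ℝ) ^ η + max C 0 * (E : ℝ) ^ θ * E := by rw [hXS]
  -- insert the count `E ≤ 2 d log(2E) #P` and the thresholds
  have i1 : (E : ℝ) * (E : ℝ) ^ η ≤
      2 * g.natDegree * Real.log (2 * (E : ℝ)) * #(rootedPrimes g E (2 * E)) * (E : ℝ) ^ η :=
    mul_le_mul_of_nonneg_right hP hS0.le
  have i2 : max C 0 * (E : ℝ) ^ θ * E ≤
      max C 0 * (E : ℝ) ^ θ * (2 * g.natDegree * Real.log (2 * (E : ℝ)) * #(rootedPrimes g E (2 * E))) :=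
    mul_le_mul_of_nonneg_left hP (mul_nonneg hCp0 hT0.le)
  have i3 : 2 * g.natDegree * Real.log (2 * (E : ℝ)) * #(rootedPrimes g E (2 * E)) * (E : ℝ) ^ η ≤
      (E : ℝ) ^ θ * #(rootedPrimes g E (2 * E)) * (E : ℝ) ^ η / 16 := by
    have := mul_le_mul_of_nonneg_right h1
      (by positivity : (0 : ℝ) ≤ #(rootedPrimes g E (2 * E)) * (E : ℝ) ^ η / 16)
    linarith
  have i4 : max C 0 * (E : ℝ) ^ θ * (2 * g.natDegree * Real.log (2 * (E : ℝ)) * #(rootedPrimes g E (2 * E))) ≤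
      (E : ℝ) ^ θ * #(rootedPrimes g E (2 * E)) * (E : ℝ) ^ η / 16 := by
    have := mul_le_mul_of_nonneg_right h2
      (by positivity : (0 : ℝ) ≤ (E : ℝ) ^ θ * #(rootedPrimes g E (2 * E)) / 16)
    linarith
  -- `#P > 0`, so the product is positive: contradiction
  have hPpos : (0 : ℝ) < #(rootedPrimes g E (2 * E)) := by
    rcases hP0.eq_or_lt with h0 | hpos
    · rw [← h0, mul_zero] at hP
      linarith
    · exact hpos
  have hprod : 0 < (E : ℝ) ^ θ * #(rootedPrimes g E (2 * E)) * (E : ℝ) ^ η := by positivity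
  linarith

end Summit.Parity.BatemanHorn.Theorems
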